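import Summits.KontsevichZagierPeriods.KontsevichZagierPeriods.Theorems.RootDecompQuadraticDescentSurdPairsP5
import Summits.KontsevichZagierPeriods.KontsevichZagierPeriods.Theses.RootDecompQuadraticDescent

/-!
# Census pairs #1 #2 (ℚ(√−7) surd), #24 #28 (dilog), #36 #37 (weight one) DECIDED in `KZ.relations` (route `RootDecompQuadraticDescent`, instances of crux stmt-KontsevichZagierPeriods-28994 `DescentTwoQ` / stmt-4280 `KZDimTwo`) · part 6/6

Cell `decomp-kz`, lens 6 (decomp-kz-lens-6 g8): the LINEAR-FIBRE STRATUM of the weight-2 box census decided by rules 1+2 in dimension 2 — general lemma `linFibre` (unfolding `s = (α(x)y+β(x))/β(x)` into a log band) + ONE base substitution by the Möbius involution `κ(t) = (1−t)/(1+t)` (`rel_subst`) + `rel_trans`; `pair1`, `pair2` (the ℚ(√−7) live benchmarks of 28994 rev 7), `pair24`, `pair28`, `pair36`, `pair37` (the latter with four `RFun.stokes` steps, rational primitives); packaged `surdPairs_decided`, `surdPairs_descentTwoQ_instances` (∀ R ⊇ relations) and `surdPairs_of_kzDimTwo` BY NAME.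

Source: `HOME/decomp-kz-lens-6/g8/SurdPairs.lean` sha256 a3f0c2d08098ea3e (1516 l; critic decomp-kz-crit-1 g2 CLEARED 2026-08-30T08:39:24Z, std axioms), split into 6 modules by the landing seat decomp-kz-census-1 g7 (contexts re-opened per part; generic docstrings added where the source had none; the route file is imported only by the last part, which proves the `KZDimTwo` corollaries BY NAME).  No `sorry`; standard axioms.  References: [cite: KontsevichZagier2001, §1.2].
-/

noncomputable section

open MeasureTheory Set MvPolynomial

namespace Summit.KontsevichZagierPeriods.RootDecompQuadraticDescent.SurdPairs

open Summit.KontsevichZagierPeriods.KontsevichZagierPeriods.Theses.RootDecompQuadraticDescent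

open Literature.NumberTheory.Transcendental
open Literature.NumberTheory.Transcendental.KZ
open Literature.ModelTheory.ExponentialFields (IsSemialgebraic)

-- PRIVATE copy (landed twins in farm-unbuilt HermiteRigidity/UnfoldedStokes modules; dedup.landed): update_one_apply_zero
/-- `update_one_apply_zero`: auxiliary theorem of the lens-6 development «surd» (instances of 28994/4280) — see the module docstring; verbatim from the lens file. -/
@[simp] private theorem update_one_apply_zero (x : Fin 2 → ℝ) (a : ℝ) : Function.update x 1 a 0 = x 0 :=
  Function.update_of_ne (by decide) a x

-- PRIVATE copy (landed twin lives in a farm-unbuilt module; dedup.landed): snoc2_zero, snoc2_one, init2_zero, isRational_rep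
/-- `snoc2_zero`: auxiliary theorem of the lens-6 development «surd» (instances of 28994/4280) — see the module docstring; verbatim from the lens file. -/
@[simp] private theorem snoc2_zero (x : Fin 1 → ℝ) (t : ℝ) : (Fin.snoc x t : Fin 2 → ℝ) 0 = x 0 := rfl

/-- `snoc2_one`: auxiliary theorem of the lens-6 development «surd» (instances of 28994/4280) — see the module docstring; verbatim from the lens file. -/
@[simp] private theorem snoc2_one (x : Fin 1 → ℝ) (t : ℝ) : (Fin.snoc x t : Fin 2 → ℝ) 1 = t := rfl

/-- `init2_zero`: auxiliary theorem of the lens-6 development «surd» (instances of 28994/4280) — see the module docstring; verbatim from the lens file. -/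
@[simp] private theorem init2_zero (z : Fin 2 → ℝ) : Fin.init z 0 = z 0 := rfl

/-- A regular rational function gives a KZ-rational representation. [folklore] -/
private theorem isRational_rep {M : ℕ} (T : RFun M) : T.rep.IsRational :=
  ⟨T.num, T.den, T.den_ne, fun _ _ => rfl⟩

/-- (e8) dyadic subdivision of the interval: `[□¹, 1/(1+u)] ≡ [□¹, 1/(2+u)] + [□¹, 1/(3+u)]`. -/
theorem e37_8 : KZ.of D1.rep - KZ.of D2.rep - KZ.of D3.rep ∈ KZ.relations := by
  refine rel_subdiv (M := 1) 0 D1 D2 D3 (fun x hx => ?_) (fun x hx => ?_)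
  · have h0 := (hx 0).1
    have hq : (2:ℝ) + x 0 ≠ 0 := by linarith
    simp only [RFun.fn, D1, D2, map_add, map_one, aeval_X, aeval_C, eq_ratCast, Rat.cast_ofNat,
      Function.update_self]
    field_simp
    try ring
  · have h0 := (hx 0).1
    have hq : (3:ℝ) + x 0 ≠ 0 := by linarith
    simp only [RFun.fn, D1, D3, map_add, map_one, aeval_X, aeval_C, eq_ratCast, Rat.cast_ofNat,
      Function.update_self]
    field_simp
    try ring

/-- **Census pair #37 DECIDED**: `2·[□², 1/(1+x+2y)] − 3·[□², 1/(1+2x+2y+x²+2xy+y²)] ∈ KZ.relations`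
(`W1/NONLINEAR`, value `2(3 log 2 − (3/2) log 3) = 3 log(4/3)`): an explicit fourteen-move chain with
rational primitives only. -/
theorem pair37 : 2 • KZ.of A37.rep - 3 • KZ.of B37.rep ∈ KZ.relations := by
  have h := sub_mem (sub_mem (add_mem (sub_mem (sub_mem (sub_mem (add_mem (sub_mem (add_mem
    (sub_mem (sub_mem (add_mem (sub_mem (add_mem (KZ.relations.zsmul_mem e37_8 (-4))
    (KZ.relations.zsmul_mem e37_4 2)) e37_5) e37_2) e37_6) e37_3) (KZ.relations.zsmul_mem e37_4' 2))
    e37_5') e37_2') (KZ.relations.zsmul_mem e37_6' 2)) e37_7') e37_3') e37_1) e37_0)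
    (KZ.relations.zsmul_mem e37_6 3)
  convert h using 1
  abel

/-- `[□², 2/(1+x+2y)] ≡ [□², 3/(1+x+y)²]`. -/
def B37three : RFun 2 := ⟨3, QB37, fun _ hx => (QB37_pos hx).ne'⟩
/-- `B37two`: auxiliary def of the lens-6 development «surd» (instances of 28994/4280) — see the module docstring; verbatim from the lens file. -/
def B37two : RFun 2 := ⟨2, QB37, fun _ hx => (QB37_pos hx).ne'⟩
/-- `pair37_equivalent`: auxiliary theorem of the lens-6 development «surd» (instances of 28994/4280) — see the module docstring; verbatim from the lens file. -/
theorem pair37_equivalent : KZ.Equivalent A37two.rep B37three.rep := by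
  have e1 := rel_triple B37 B37two B37three
    (fun x _ => by simp only [RFun.fn, B37, B37two, map_one, map_ofNat]; ring)
    (fun x _ => by simp only [RFun.fn, B37, B37two, B37three, map_one, map_ofNat]; ring)
  have h := sub_mem (add_mem pair37 e37_0) e1
  show KZ.of A37two.rep - KZ.of B37three.rep ∈ KZ.relations
  convert h using 1
  abel

/-- `pair37_value`: auxiliary theorem of the lens-6 development «surd» (instances of 28994/4280) — see the module docstring; verbatim from the lens file. -/
theorem pair37_value : A37two.rep.value = B37three.rep.value :=
  KZ.Equivalent.value_eq_holds pair37_equivalent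

/-! ## §5 The six pairs as DECIDED INSTANCES of the route items -/

/-- The four linear-fibre census pairs are equal-valued pairs of two-dimensional KZ-rational
representations on the closed square whose difference is a relation — the conclusion of `KZDimTwo`
(item 4280) ABSOLUTELY, hence that of `DescentTwoQ` (item 28994) modulo every `R ⊇ KZ.relations`,
whatever the oracle. -/
theorem surdPairs_decided :
    (A1.rep.IsRational ∧ B1.rep.IsRational ∧ A1.rep.value = B1.rep.value ∧ KZ.Equivalent A1.rep B1.rep) ∧
    (A2.rep.IsRational ∧ B2.rep.IsRational ∧ A2.rep.value = B2.rep.value ∧ KZ.Equivalent A2.rep B2.rep) ∧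
    (A24.rep.IsRational ∧ B24.rep.IsRational ∧ A24.rep.value = B24.rep.value ∧
      KZ.Equivalent A24.rep B24.rep) ∧
    (A28.rep.IsRational ∧ B28two.rep.IsRational ∧ A28.rep.value = B28two.rep.value ∧
      KZ.Equivalent A28.rep B28two.rep) :=
  ⟨⟨isRational_rep _, isRational_rep _, pair1_value, pair1_equivalent⟩,
   ⟨isRational_rep _, isRational_rep _, pair2_value, pair2_equivalent⟩,
   ⟨isRational_rep _, isRational_rep _, pair24_value, pair24_equivalent⟩,
   ⟨isRational_rep _, isRational_rep _, pair28_value, pair28_equivalent⟩⟩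

/-- The two weight-one census pairs (#36, #37) in the same packaged form
(`[□², 2/(1+y)] ~ [□², 3/(2+y−y²)]`, `[□², 2/(1+x+2y)] ~ [□², 3/(1+x+y)²]`). -/
theorem weightOnePairs_decided :
    (P36two.rep.IsRational ∧ T36three.rep.IsRational ∧ P36two.rep.value = T36three.rep.value ∧
      KZ.Equivalent P36two.rep T36three.rep) ∧
    (A37two.rep.IsRational ∧ B37three.rep.IsRational ∧ A37two.rep.value = B37three.rep.value ∧
      KZ.Equivalent A37two.rep B37three.rep) :=
  ⟨⟨isRational_rep _, isRational_rep _, pair36_value, pair36_equivalent⟩,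
   ⟨isRational_rep _, isRational_rep _, pair37_value, pair37_equivalent⟩⟩

/-- Relative form: the six census differences lie in every additive subgroup `R ⊇ KZ.relations` —
the instances of the conclusion of `DescentTwoQ` (item 28994) at these pairs, with NO use of its
oracle hypotheses. -/
theorem surdPairs_descentTwoQ_instances (R : AddSubgroup KZ.FormalRep) (hR : KZ.relations ≤ R) :
    KZ.of A1.rep - KZ.of B1.rep ∈ R ∧ KZ.of A2.rep - KZ.of B2.rep ∈ R ∧
      KZ.of A24.rep - KZ.of B24.rep ∈ R ∧ KZ.of A28.rep - 2 • KZ.of B28.rep ∈ R ∧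
      2 • KZ.of P36.rep - 3 • KZ.of T36.rep ∈ R ∧ 2 • KZ.of A37.rep - 3 • KZ.of B37.rep ∈ R :=
  ⟨hR pair1, hR pair2, hR pair24, hR pair28, hR pair36, hR pair37⟩

/-- Sanity link to the route: `KZDimTwo` (item 4280) also yields these congruences (instances at
`n = m = 2`); the point of this file is that they hold unconditionally. -/
theorem surdPairs_of_kzDimTwo (h : KZDimTwo) :
    KZ.Equivalent A1.rep B1.rep ∧ KZ.Equivalent A2.rep B2.rep ∧
      KZ.Equivalent A24.rep B24.rep ∧ KZ.Equivalent A28.rep B28two.rep ∧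
      KZ.Equivalent P36two.rep T36three.rep ∧ KZ.Equivalent A37two.rep B37three.rep :=
  ⟨h le_rfl le_rfl _ _ (isRational_rep _) (isRational_rep _) pair1_value,
   h le_rfl le_rfl _ _ (isRational_rep _) (isRational_rep _) pair2_value,
   h le_rfl le_rfl _ _ (isRational_rep _) (isRational_rep _) pair24_value,
   h le_rfl le_rfl _ _ (isRational_rep _) (isRational_rep _) pair28_value,
   h le_rfl le_rfl _ _ (isRational_rep _) (isRational_rep _) pair36_value,
   h le_rfl le_rfl _ _ (isRational_rep _) (isRational_rep _) pair37_value⟩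

/-- info: 'Summit.KontsevichZagierPeriods.RootDecompQuadraticDescent.SurdPairs.surdPairs_decided' depends on axioms: [propext,
 Classical.choice,
 Quot.sound] -/
#guard_msgs in #print axioms surdPairs_decided

/-- info: 'Summit.KontsevichZagierPeriods.RootDecompQuadraticDescent.SurdPairs.weightOnePairs_decided' depends on axioms: [propext,
 Classical.choice,
 Quot.sound] -/
#guard_msgs in #print axioms weightOnePairs_decided

/-- info: 'Summit.KontsevichZagierPeriods.RootDecompQuadraticDescent.SurdPairs.surdPairs_descentTwoQ_instances' depends on axioms: [propext,
 Classical.choice,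
 Quot.sound] -/
#guard_msgs in #print axioms surdPairs_descentTwoQ_instances

end Summit.KontsevichZagierPeriods.RootDecompQuadraticDescent.SurdPairs

end
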